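import Summits.BirchSwinnertonDyer.BirchSwinnertonDyer.Theorems.ThetaPartnerAtTwoSignedKatoUpToAtTwoFlatEqualsPlus
import Summits.BirchSwinnertonDyer.BirchSwinnertonDyer.Theorems.ThetaPartnerAtTwoSignedControlAtTwoStubPlusHondaSystemTwo
import Literature.NumberTheory.EllipticCurves.CyclotomicZpExtensionLocalGeneratorProofs
import HarnessLib

/-!
# Route `ThetaPartnerAtTwo` (TP2), crux K3 `SignedKatoDivisibilityUpToAtTwo` (item stmt-BirchSwinnertonDyer-20308),
# line `colemanrat` — file 21: **`Sel⁺(E/ℚ_∞) = Sel♭(E/ℚ_∞)` AT `a_2 = 0`, UNCONDITIONALLY** (HONDA⁺@2 discharged by the K4 seats'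
# theorem `SignedEC.PlusLayer.plusHondaSystemTwo_padic` + `SignedEC.plusHondaSystem_adicCompletion_of_padic_nonDiv`), with the dual
# consequences `X♭ ≃ X⁺`, `ℓ_𝔭(X♭) = ℓ_𝔭(X⁺)`, `Char(X♭) = Char(X⁺)` for the pinned data — for EVERY globally minimal elliptic `W/ℚ`
# with good supersingular reduction at `2` and `a_2 = 0`, the cyclotomic `ℤ₂`-extension, the place `v ∋ 2` and any local lift `g`

Width seat `bsd-wall-tp2-p2x-w2` g2 (cell `bsd-wall`). HONEST FRAMING: THEOREMS ONLY — no definition, no named fact, no instance,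
no `sorry`; route-independent (no `Theses` import); closes no item; NOTHING is asserted about any `p`-adic `L`-function or main
conjecture; BSD is NOT proved by any of this.

## Why this file

File 20 proved `Sel⁺ = Sel♭` at `2` modulo the four plus Honda clauses (L) (TR) (GEN) (GEN₀) at (`W`, `κ`, `v`). Those clauses are
now a TREE THEOREM for every `W/ℚ` globally minimal with `GoodSS W 2`, `a_2(W) = 0` and the cyclotomic `κ` (K4 seats, files
`…SignedControlAtTwoPlusHonda*`, `…LocalTwoPlusPoints*`, assembled in `…StubPlusHondaSystemTwo`: the lead's `ℤ₂`-tower points with exact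
trace relations, Kobayashi Prop. 8.12 at `2`, transport `ℚ_[2] → ℚ_v`, (GEN₀) from `d_0 ∉ 2E(ℚ₂)`). Plugging them in: Kobayashi's
`Sel⁺(E/ℚ_∞)` (K3's object, via `SignedSelmerDualData`) and Sprung's `Sel♭(E/ℚ_∞)` for the K4 Honda system (the `bsd-2adic` cell's
object at `a_2 = 0`, via `SharpFlatSelmerDualData`) are THE SAME GROUP, and their pinned Pontryagin duals are isomorphic `Λ`-modules —
no hypothesis left except the choice of the local generator lift `g` (which exists:
`ZpExtension.IsCyclotomic.exists_isTopGenerator_resGalOfEmb_adicCompletion`). So K3's certified local form off `2` and the ♭-Kato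
divisibility off `2` (file 19's (F)) are EQUIVALENT statements, and results proved on either side transfer.

## What is proved (`W/ℚ` elliptic globally minimal, `hss : GoodSS W 2`, `ha : a_2(W) = 0`, `κ` cyclotomic, `v ∋ 2`)

* `exists_plusHondaSystem_two` — HONDA⁺@2 at (`W`, `κ`, `v`): `∃ d` with (L) (TR) (GEN) (GEN₀) (K4's theorems, repackaged in the
  `localLayerPoints`/`localTrace` abbreviation currency).
* **`sharpFlat_signed_agree_two`** — for any local lift `g`: `∃ d` (the four clauses) with `Sel⁺(E/ℚ_∞) = Sel♭(E/ℚ_∞)` and, for every `γ`,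
  every pinned `D : SignedSelmerDualData W κ γ 1` and every pinned `D♭ : SharpFlatSelmerDualData W κ γ (closureEmb ℚ_v) 0 g d .flat`:
  `D♭.X ≃ₗ[Λ] D.X`, `ℓ_𝔭(D♭.X) = ℓ_𝔭(D.X)` for all `𝔭`, `Char(D♭.X) = Char(D.X)`, `D♭.X` torsion iff `D.X` torsion.
* `exists_signedSelmerInfty_eq_sharpFlatSelmerInfty_two` — fully existential form (`∃ v g d`, `Sel⁺ = Sel♭`).
* `exists_sharpFlatDual_linearEquiv_signed_two` — for every pinned `D` there are `v, g, d` and a ♭ dual datum `D♭` (Sprung's construction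
  `nonempty_sharpFlatSelmerDualData'`) with `D♭.X ≃ₗ[Λ] D.X`.

References: [Kobayashi2003] S. Kobayashi, Invent. Math. 152 (2003), Def. 1.1, Thm. 6.2, §8.4 (Props. 8.7, 8.11, 8.12), Prop. 8.18–8.23;
[Sprung2012] F. Sprung, J. Number Theory 132 (2012), §1 p. 1486, Def. 7.9–7.11, Thm. 7.14; [KuriharaOtsuki2006] p. 557.
-/

set_option autoImplicit false
-- the Theorems namespace of this sub repeats the summit name by design (D-0017 nested layout)
set_option linter.dupNamespace false

noncomputable section

open scoped Classical NumberField

universe u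

namespace Summit.BirchSwinnertonDyer.BirchSwinnertonDyer.Theorems

namespace SignedKatoOffTwo.FlatKernel

open NumberField IsDedekindDomain WeierstrassCurve Literature.NumberTheory.EllipticCurves
  Literature.NumberTheory.GaloisRepresentations Literature.NumberTheory.EllipticCurves.ZpExtension
  Literature.NumberTheory.EllipticCurves.Kobayashi2003 Literature.NumberTheory.EllipticCurves.Sprung2017
  Literature.NumberTheory.EllipticCurves.Sprung2012 Literature.NumberTheory.EllipticCurves.Rank1Residual
  Literature.NumberTheory.EllipticCurves.Module

variable (W : WeierstrassCurve ℚ) [W.IsElliptic] [W.IsGloballyMinimal]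

/-- A finite place of `ℚ` above `2` exists. [folklore] -/
private theorem exists_heightOneSpectrum_two_mem' : ∃ v : HeightOneSpectrum (𝓞 ℚ), (2 : 𝓞 ℚ) ∈ v.asIdeal := by
  have hnu : ¬ IsUnit ((2 : ℕ) : 𝓞 ℚ) := by
    intro h
    have h' := h.map Rat.ringOfIntegersEquiv
    rw [map_natCast, Int.isUnit_iff_natAbs_eq, Int.natAbs_natCast] at h'
    exact absurd h' (by norm_num)
  obtain ⟨M, hM, hle⟩ := Ideal.exists_le_maximal (Ideal.span {((2 : ℕ) : 𝓞 ℚ)})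
    (by rwa [Ne, Ideal.span_singleton_eq_top])
  have h2M : ((2 : ℕ) : 𝓞 ℚ) ∈ M := hle (Ideal.mem_span_singleton_self _)
  refine ⟨⟨M, hM.isPrime, fun hbot => ?_⟩, by exact_mod_cast h2M⟩
  rw [hbot, Ideal.mem_bot] at h2M
  exact absurd (by exact_mod_cast h2M : (2 : ℕ) = 0) (by norm_num)

/-- **HONDA⁺@2 at (`W`, `κ`, `v`)** — the four plus Honda clauses (L) (TR) (GEN) (GEN₀) over (`ℚ_v`, `closureEmb`) for a globally minimal
`W/ℚ` with `GoodSS W 2`, `a_2(W) = 0` and the cyclotomic `κ`: the K4 seats' `SignedEC.PlusLayer.plusHondaSystemTwo_padic` (over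
`ℚ_[2]`, every `ι`) transported by `SignedEC.plusHondaSystem_adicCompletion_of_padic_nonDiv`. [cite: Kobayashi2003, §8.4 (Props. 8.7, 8.11, 8.12)]
[cite: KuriharaOtsuki2006, p. 557] -/
theorem exists_plusHondaSystem_two (hss : GoodSS W 2) (ha : W.frobeniusTrace 2 = 0) {κ : ZpExtension ℚ 2} (hκ : κ.IsCyclotomic)
    (v : HeightOneSpectrum (𝓞 ℚ)) (hv : (2 : 𝓞 ℚ) ∈ v.asIdeal) :
    ∃ d : ℕ → localPoints W (v.adicCompletion ℚ),
      (∀ m, d m ∈ localLayerPoints κ (v.adicCompletion ℚ) W m) ∧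
      (∀ m, localTrace κ (v.adicCompletion ℚ) W (m + 1) (m + 2) (d (m + 2)) = -d m) ∧
      (∀ m : ℕ, 1 ≤ m → ∀ P ∈ localLayerPoints κ (v.adicCompletion ℚ) W m,
        ∃ B ∈ AddSubgroup.closure (Set.range fun σ : Field.absoluteGaloisGroup (v.adicCompletion ℚ) ↦ σ • d m),
          ∃ P' ∈ localLayerPoints κ (v.adicCompletion ℚ) W (m - 1),
            ∃ R ∈ localLayerPoints κ (v.adicCompletion ℚ) W m, P = B + P' + 2 • R) ∧
      (∀ P ∈ localLayerPoints κ (v.adicCompletion ℚ) W 0,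
        ∃ a : ℤ, ∃ R ∈ localLayerPoints κ (v.adicCompletion ℚ) W 0, P = a • d 0 + 2 • R) :=
  SignedEC.plusHondaSystem_adicCompletion_of_padic_nonDiv W hss κ v hv
    fun ι => SignedEC.PlusLayer.plusHondaSystemTwo_padic W hss ha κ hκ ι

/-- **`Sel⁺(E/ℚ_∞) = Sel♭(E/ℚ_∞)` at `a_2 = 0`, with all dual consequences — UNCONDITIONAL.** For `W/ℚ` elliptic globally minimal with
`GoodSS W 2` and `a_2(W) = 0`, the cyclotomic `κ`, the place `v ∋ 2` and any local lift `g` of the topological generator, there is a plus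
Honda system `d` at `2` ((L) (TR) (GEN) (GEN₀)) such that Kobayashi's `signedSelmerInfty W κ 1` EQUALS Sprung's
`sharpFlatSelmerInfty W κ (closureEmb ℚ_v) 0 g d .flat`, and for every `γ`, every pinned `D : SignedSelmerDualData W κ γ 1` and every pinned
`D♭ : SharpFlatSelmerDualData W κ γ (closureEmb ℚ_v) 0 g d .flat`: `D♭.X ≃ₗ[Λ] D.X`, `ℓ_𝔭(D♭.X) = ℓ_𝔭(D.X)` (all `𝔭`), `Char(D♭.X) = Char(D.X)`,
and `D♭.X` is `Λ`-torsion iff `D.X` is. [cite: Kobayashi2003, Def. 1.1, Thm. 6.2, Prop. 8.18–8.23]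
[cite: Sprung2012, §1 p. 1486, Def. 7.11, Thm. 7.14 (pp. 1503–1504)] [cite: KuriharaOtsuki2006, p. 557] -/
theorem sharpFlat_signed_agree_two (hss : GoodSS W 2) (ha : W.frobeniusTrace 2 = 0) {κ : ZpExtension ℚ 2} (hκ : κ.IsCyclotomic)
    (v : HeightOneSpectrum (𝓞 ℚ)) (hv : (2 : 𝓞 ℚ) ∈ v.asIdeal) {g : Field.absoluteGaloisGroup (v.adicCompletion ℚ)}
    (hg : κ.IsTopGenerator (resGalOfEmb (closureEmb (K := ℚ) (v.adicCompletion ℚ)) g)) :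
    ∃ d : ℕ → localPoints W (v.adicCompletion ℚ),
      (∀ m, d m ∈ localLayerPoints κ (v.adicCompletion ℚ) W m) ∧
      (∀ m, localTrace κ (v.adicCompletion ℚ) W (m + 1) (m + 2) (d (m + 2)) = -d m) ∧
      (∀ m : ℕ, 1 ≤ m → ∀ P ∈ localLayerPoints κ (v.adicCompletion ℚ) W m,
        ∃ B ∈ AddSubgroup.closure (Set.range fun σ : Field.absoluteGaloisGroup (v.adicCompletion ℚ) ↦ σ • d m),
          ∃ P' ∈ localLayerPoints κ (v.adicCompletion ℚ) W (m - 1),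
            ∃ R ∈ localLayerPoints κ (v.adicCompletion ℚ) W m, P = B + P' + 2 • R) ∧
      (∀ P ∈ localLayerPoints κ (v.adicCompletion ℚ) W 0,
        ∃ a : ℤ, ∃ R ∈ localLayerPoints κ (v.adicCompletion ℚ) W 0, P = a • d 0 + 2 • R) ∧
      signedSelmerInfty W κ 1 = sharpFlatSelmerInfty W κ (closureEmb (K := ℚ) (v.adicCompletion ℚ)) 0 g d .flat ∧
      ∀ {γ : Field.absoluteGaloisGroup ℚ} (D : SignedSelmerDualData W κ γ 1)
        (Df : SharpFlatSelmerDualData W κ γ (closureEmb (K := ℚ) (v.adicCompletion ℚ)) 0 g d .flat),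
        Nonempty (Df.X ≃ₗ[IwasawaAlgebra 2] D.X) ∧
        (∀ 𝔭 : PrimeSpectrum (IwasawaAlgebra 2), lengthAt (IwasawaAlgebra 2) Df.X 𝔭 = lengthAt (IwasawaAlgebra 2) D.X 𝔭) ∧
        Df.charIdeal = D.charIdeal ∧
        (Module.IsTorsion (IwasawaAlgebra 2) Df.X ↔ Module.IsTorsion (IwasawaAlgebra 2) D.X) := by
  obtain ⟨d, hd, htr, hgen, hgen0⟩ := exists_plusHondaSystem_two W hss ha hκ v hv
  have heq := signedSelmerInfty_eq_sharpFlatSelmerInfty_flat_two W hss hκ v hv hg hd htr hgen hgen0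
  exact ⟨d, hd, htr, hgen, hgen0, heq, fun D Df =>
    ⟨nonempty_linearEquiv_sharpFlat_signed W κ _ g d heq Df D,
      fun 𝔭 => lengthAt_sharpFlat_eq_lengthAt_signed W κ _ g d heq Df D 𝔭,
      charIdeal_sharpFlat_eq_charIdeal_signed W κ _ g d heq Df D,
      isTorsion_sharpFlat_iff_isTorsion_signed W κ _ g d heq Df D⟩⟩

/-- **`Sel⁺(E/ℚ_∞) = Sel♭(E/ℚ_∞)` at `a_2 = 0` — fully existential form**: for `W/ℚ` elliptic globally minimal with `GoodSS W 2`,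
`a_2(W) = 0` and the cyclotomic `κ`, there are the place `v ∋ 2`, a local lift `g` of the topological generator and a Honda system `d`
of `a_2 = 0` shape with `signedSelmerInfty W κ 1 = sharpFlatSelmerInfty W κ (closureEmb ℚ_v) 0 g d .flat`.
[cite: Kobayashi2003, Def. 1.1, Thm. 6.2] [cite: Sprung2012, §1 p. 1486, Def. 7.11] -/
theorem exists_signedSelmerInfty_eq_sharpFlatSelmerInfty_two (hss : GoodSS W 2) (ha : W.frobeniusTrace 2 = 0)
    {κ : ZpExtension ℚ 2} (hκ : κ.IsCyclotomic) :
    ∃ (v : HeightOneSpectrum (𝓞 ℚ)) (_ : (2 : 𝓞 ℚ) ∈ v.asIdeal) (g : Field.absoluteGaloisGroup (v.adicCompletion ℚ))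
      (d : ℕ → localPoints W (v.adicCompletion ℚ)),
      κ.IsTopGenerator (resGalOfEmb (closureEmb (K := ℚ) (v.adicCompletion ℚ)) g) ∧
      (∀ m, d m ∈ localLayerPoints κ (v.adicCompletion ℚ) W m) ∧
      (∀ m, localTrace κ (v.adicCompletion ℚ) W (m + 1) (m + 2) (d (m + 2)) = -d m) ∧
      signedSelmerInfty W κ 1 = sharpFlatSelmerInfty W κ (closureEmb (K := ℚ) (v.adicCompletion ℚ)) 0 g d .flat := by
  obtain ⟨v, hv⟩ := exists_heightOneSpectrum_two_mem'
  obtain ⟨g, hg⟩ := hκ.exists_isTopGenerator_resGalOfEmb_adicCompletion v (by exact_mod_cast hv)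
  obtain ⟨d, hd, htr, -, -, heq, -⟩ := sharpFlat_signed_agree_two W hss ha hκ v hv hg
  exact ⟨v, hv, g, d, hg, hd, htr, heq⟩

/-- **Every pinned `X⁺(E/ℚ_∞)` is a pinned `X♭(E/ℚ_∞)`**: for `W/ℚ` elliptic globally minimal with `GoodSS W 2`, `a_2(W) = 0`, the
cyclotomic `κ`, any `γ` and any `D : SignedSelmerDualData W κ γ 1` (K3's object), there are `v ∋ 2`, a local lift `g`, a Honda system `d`
and a ♭ dual datum `D♭ : SharpFlatSelmerDualData W κ γ (closureEmb ℚ_v) 0 g d .flat` (Sprung's construction) with `D♭.X ≃ₗ[Λ] D.X`.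
[cite: Sprung2012, Def. 7.11 and Thm. 7.14 (pp. 1503–1504)] [cite: Kobayashi2003, Thm. 1.2] -/
theorem exists_sharpFlatDual_linearEquiv_signed_two (hss : GoodSS W 2) (ha : W.frobeniusTrace 2 = 0)
    {κ : ZpExtension ℚ 2} (hκ : κ.IsCyclotomic) {γ : Field.absoluteGaloisGroup ℚ} (D : SignedSelmerDualData W κ γ 1) :
    ∃ (v : HeightOneSpectrum (𝓞 ℚ)) (_ : (2 : 𝓞 ℚ) ∈ v.asIdeal) (g : Field.absoluteGaloisGroup (v.adicCompletion ℚ))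
      (d : ℕ → localPoints W (v.adicCompletion ℚ))
      (Df : SharpFlatSelmerDualData W κ γ (closureEmb (K := ℚ) (v.adicCompletion ℚ)) 0 g d .flat),
      κ.IsTopGenerator (resGalOfEmb (closureEmb (K := ℚ) (v.adicCompletion ℚ)) g) ∧
      (∀ m, d m ∈ localLayerPoints κ (v.adicCompletion ℚ) W m) ∧
      (∀ m, localTrace κ (v.adicCompletion ℚ) W (m + 1) (m + 2) (d (m + 2)) = -d m) ∧
      Nonempty (Df.X ≃ₗ[IwasawaAlgebra 2] D.X) := by
  obtain ⟨v, hv⟩ := exists_heightOneSpectrum_two_mem'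
  obtain ⟨g, hg⟩ := hκ.exists_isTopGenerator_resGalOfEmb_adicCompletion v (by exact_mod_cast hv)
  obtain ⟨d, hd, htr, -, -, -, hdual⟩ := sharpFlat_signed_agree_two W hss ha hκ v hv hg
  obtain ⟨Df⟩ := nonempty_sharpFlatSelmerDualData' W κ (closureEmb (K := ℚ) (v.adicCompletion ℚ)) (0 : ℤ) g d
    Chroma.flat γ
  exact ⟨v, hv, g, d, Df, hg, hd, htr, (hdual D Df).1⟩

end SignedKatoOffTwo.FlatKernel

end Summit.BirchSwinnertonDyer.BirchSwinnertonDyer.Theorems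

end
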